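import Mathlib
import Summits.NavierStokesRegularity.NavierStokesRegularity.Theorems.TaoLadderRungTwoBreakOneShiftWindowK1GlueC
import Summits.NavierStokesRegularity.NavierStokesRegularity.Theorems.TaoLadderRungTwoBreakOneShiftWindowK3LinkD
import Summits.NavierStokesRegularity.NavierStokesRegularity.Theorems.TaoLadderRungTwoBreakOneShiftWindowStepEndI
import HarnessLib

/-!
# The one-shift window system, LIII: THE FRAME-LEVEL GLUE TO (K3) FOR THE CENTRED GRID — the centre residual clause of
# part V from the grid Booleans, the point-box chain of part XLIX (the reference run IS the centre run: an `AdmLip` point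
# with zero scaled window coordinates and zero scaled flight time starts at `ŷ` and reads the residual at `τc`), the
# interval-time end box of part LI on the final step (`zlinkOK`: `endBoxROnI P_S TI ⊆ Zc`), and the centre-residual Boolean of
# part LII (cell harvest/h2-tao-ladder, seat p2; rung1/KERNEL-CHEAP-REPLAY-SPEC.md §2 (Krawczyk file), §6 (ii); support for
# K1(1) = `NoSurvivingDSSOne`, stmt-NavierStokesRegularity-20205)

MODEL lattice ODEs only (Tao 2016 §4 normal form on Tao's shift set `S`); nothing here is a statement about
the Navier–Stokes equations; no item is closed; no instance is evaluated here.

* `K3_of_gridC` — **(K3) with `Y = YD` and the preconditioner `linOfMatrix (CmatR)`** (the same `C` as `K1_of_gridC` when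
  `k3.kd` is the Krawczyk datum of the (K1) link), i.e. together with part L the two hypotheses of part V `krawczyk_winIn`
  (the Krawczyk INCLUSION clause `hwinIn`) are reduced to Booleans over emitted data plus instance facts.
-/

noncomputable section

-- the sub-problem namespace repeats the summit name by design (D-0017)
set_option linter.dupNamespace false

namespace Summit.NavierStokesRegularity.NavierStokesRegularity.Theorems

namespace DSSOneShift

open Set Finset Metric Filter Topology TopologicalSpace
open Literature.Analysis.ODE Literature.Analysis.FluidPDE Literature.Analysis.FluidPDE.TaoCascade
open Summit.NavierStokesRegularity.NavierStokesRegularity.Theorems.TaylorModelCert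
open Summit.NavierStokesRegularity.NavierStokesRegularity.Theorems.TaylorModelReadout
open Summit.NavierStokesRegularity.NavierStokesRegularity.Theorems.CertificateGlueOn

variable {m : ℕ}

namespace OneShiftFrame

variable (F : OneShiftFrame m)

section Glue

variable {ε₀ : ℝ} {α : Fin m → Fin m → Fin m → ℤ × ℤ × ℤ → ℝ} {R : ℤ → ℝ}
variable {g : GridCD} {k3 : K3D} {e : F.SIdx ≃ Fin g.n}
variable {κ : Type*} [Fintype κ]

/-- **(K3) FROM THE CENTRED GRID, THE INTERVAL-TIME END BOX AND THE CENTRE-RESIDUAL BOOLEAN.** For a one-shift frame `F` at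
`(ε₀, α)`, a centred grid `g` and a centre-residual datum `k3` whose Krawczyk datum matches the frame (`FrameMatch`), term data
presenting the realisations (`hRDc`, `hRD`, `hTf`), all grid Booleans, `ŷ ∈ P_0`, `ŷ ∈ ycB`, `strig ∈ strigB`, `τc − t_S ∈ TI`,
the link `endBoxROnI P_S TI ⊆ Zc` and `K3D.check`: the centre residual clause (K3) of part V holds with `Y = YD` for the
linear preconditioner of `Cmat`. [cite: Tao2016AveragedNS, §5.3; Moore1979, §3.2 and §8.1; cell vocabulary, harvest/h2-tao-ladder rung1/STAGE2-LEMMA.md §3 (‖C G(x̂)‖ ≤ Y), rung1/KERNEL-CHEAP-REPLAY-SPEC.md §2/§9] -/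
theorem K3_of_gridC (hε : 0 ≤ ε₀) (hα : IsCancellingCoeff α)
    (hEb : ∀ i, |F.tubeC i (-1)| + F.tubeR (-1) ≤ F.Eb) (hEt : ∀ i, |F.tubeC i F.W| + F.tubeR F.W ≤ F.Et)
    (M : F.FrameMatch g.toGridD k3.kd e R) (hkn : k3.kd.rs.n = g.n)
    (Tc : ℕ → κ → BTerm F.SIdx) (rows : F.SIdx → List κ) (Tf : F.Space → ℝ → κ → BTerm F.SIdx)
    (hTf : ∀ u, F.AdmLip R u → ∀ t x, termField (Tf u t) x = F.wfieldFlat ε₀ α (F.preclampTail u) t x)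
    (hRDc : ∀ s ≤ g.S, IsRTEncl (g.es e M.hn s) (Tc s) (Tc s) rows (g.step s).RD)
    (hRD : ∀ u, F.AdmLip R u → ∀ s ≤ g.S, ∀ r ∈ Ico 0 (g.h s).toReal,
      IsRTEncl (g.es e M.hn s) (Tc s) (Tf u (g.t s + r)) rows (g.step s).RD)
    (hstep : ∀ s ≤ g.S, g.stepOK s = true) (hinit : g.initOK = true) (hprod : ∀ s ≤ g.S, g.prodOK s = true)
    (hpwf : ∀ s ≤ g.S, g.pwfOK s = true) (hpsub : ∀ s ≤ g.S, g.psubOK s = true)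
    (hplink : ∀ s < g.S, g.plinkOK s = true) (hwlink : ∀ s < g.S, g.wlinkOK s = true)
    (hP0 : (fun c : F.SIdx => F.yc c.1 ((c.2 : ℕ) : ℤ)) ∈ boxSet (boxOf e (g.P 0)))
    (hyc : ∀ i (j : Fin F.W), IntervalD.mem (F.yc i ((j : ℕ) : ℤ)) (IntervalD.aget k3.ycB (e (i, j))))
    (hstrig : IntervalD.mem F.strig k3.strigB) (hTI : IntervalD.mem (F.τc - g.t g.S) k3.TI)
    (hzlink : ∀ c < g.n, IntervalD.subset ((g.step g.S).toRoughStepD.endBoxROnI (g.P g.S) k3.TI c) (IntervalD.aget k3.Zc c) = true)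
    (hK3 : k3.check = true) :
    ∀ u, F.AdmLip R u → u.1 = 0 → u.2.1 = 0 →
      (∀ i j, |(F.precondResidual ε₀ α (F.linOfMatrix (k3.kd.CmatR F (e.trans (finCongr hkn.symm)))) u).1 i j| ≤
        k3.YD.toReal) ∧
      |(F.precondResidual ε₀ α (F.linOfMatrix (k3.kd.CmatR F (e.trans (finCongr hkn.symm)))) u).2| ≤ k3.YD.toReal := by
  classical
  have hW1 := M.hW1
  have hDW := M.hDW
  have hn := M.hn
  have hW : 0 < F.W := lt_trans zero_lt_one hW1
  set ek : F.SIdx ≃ Fin k3.kd.rs.n := e.trans (finCongr hkn.symm) with hekdef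
  have hek : ∀ p : F.SIdx, ((ek p : Fin k3.kd.rs.n) : ℕ) = (e p : ℕ) := fun p => by simp [hekdef]
  refine F.K3_of_centreRun (F.linOfMatrix (k3.kd.CmatR F ek)) (F.coord_linOfMatrix (k3.kd.CmatR F ek)) R
    (k3.zlo F ek) (k3.zhi F ek) ?_ ?_
  swap
  · -- the finite check (part LII)
    exact k3.hY_of_check (F := F) (e := ek) hW1 hDW M.hm
      (fun i j => by
        have h := M.hsucc i j
        rw [hek, h]
        split_ifs with hj
        · rw [hek]
        · rfl)
      (fun i j => by rw [hek]; exact M.hmode i j) (fun i => by rw [hek]; exact M.hidx1 i)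
      (fun i => by rw [hek]; exact M.hidxD i) (fun i j => by rw [hek]; exact M.ha i j) M.hrτ M.hTtop
      (fun i j => by rw [hek]; exact hyc i j) hstrig hK3
  -- the hull of the centre run at the flight-time centre
  intro u hu h1 h2 i kk hk
  -- facts of the final step
  have hchkS : (g.step g.S).check = true := by
    have := hstep g.S le_rfl
    simp only [GridD.stepOK, Bool.and_eq_true, decide_eq_true_eq] at this
    exact this.1
  have hc' : (g.step g.S).toRoughStepD.check = true ∧ (g.step g.S).checkPair = true := by
    simpa [PairStepD.check, Bool.and_eq_true] using hchkS
  have hh : ∀ s ≤ g.S, 0 ≤ (g.h s).toReal := fun s hs => (g.h_nonneg_and_wfW (hstep s hs)).1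
  have hwfP : ∀ c < (g.step g.S).n, wfD (IntervalD.aget (g.P g.S) c) = true := fun c hc =>
    GridCD.of_all_range (hpwf g.S le_rfl) c (by rw [← hn g.S]; exact hc)
  have hpsubS : ∀ c < (g.step g.S).n,
      IntervalD.subset (IntervalD.aget (g.P g.S) c) (IntervalD.aget (g.step g.S).W c) = true := fun c hc =>
    GridCD.of_all_range (hpsub g.S le_rfl) c (by rw [← hn g.S]; exact hc)
  -- the run of `u` and its flat start `ŷ`
  set Su := F.windowRunMap ε₀ α (F.preclampY u) (F.preclampTail u) with hSudef
  have hSu : F.IsRunFrom ε₀ α (F.preclampY u) (F.preclampTail u) Su := F.isRunFrom_windowRunMap hε hW hα hEb hEt hu.1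
  have hfu : ∀ t ∈ Icc 0 F.τhi, HasDerivWithinAt (F.flatRun Su) (termField (Tf u t) (F.flatRun Su t)) (Icc 0 F.τhi) t := by
    intro t ht
    have h := F.hasDerivWithinAt_flatRun hSu ht
    rwa [← hTf u hu t] at h
  have hclamp0 : clampUnit 0 = 0 := by simp only [clampUnit]; norm_num
  have ha0 : F.flatRun Su 0 = fun c : F.SIdx => F.yc c.1 ((c.2 : ℕ) : ℤ) := by
    funext c
    rw [F.flatRun_zero hSu c, F.preclampY_natCast]
    have hu0 : u.1 c.1 c.2 = 0 := by rw [h1]; rfl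
    rw [hu0, hclamp0, mul_zero, add_zero]
  have haW : (fun c : F.SIdx => F.yc c.1 ((c.2 : ℕ) : ℤ)) ∈ boxSet (boxOf e (g.step 0).W) :=
    M.hW0 _ fun c => by simp [(F.a_pos c.1 _).le]
  -- times
  have hτc := F.τc_gt
  have hrτ := F.rτ_pos
  have htS' : g.t g.S ≤ F.τhi := M.htS.trans (by unfold τhi; linarith)
  have hτ' : F.τhi - g.t g.S ∈ Icc 0 (g.h g.S).toReal := ⟨by linarith, by linarith [M.hTS]⟩
  have ht : F.τc - g.t g.S ∈ Icc 0 (F.τhi - g.t g.S) := ⟨by linarith [M.htS], by unfold τhi; linarith⟩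
  -- the point-box chain: the run is its own reference run
  obtain ⟨hPS, -, -⟩ := g.mem_start_of_gridC e hn hRDc (hRD u hu) hstep hinit (fun s hs => hprod s hs.le) hpwf hpsub
    hplink hwlink htS' hP0 ha0 hfu haW ha0 hfu g.S le_rfl
  -- the final step up to the flight end, read at `τc`
  have ht0S : 0 ≤ g.t g.S := g.t_nonneg fun k hk => hh k hk.le
  have hrun : ∀ r ∈ Icc 0 (F.τhi - g.t g.S), HasDerivWithinAt (fun r => F.flatRun Su (g.t g.S + r))
      (termField (Tf u (g.t g.S + r)) (F.flatRun Su (g.t g.S + r))) (Icc 0 (F.τhi - g.t g.S)) r :=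
    fun r hr => hasDerivWithinAt_shift (S := F.flatRun Su) (S' := fun t => termField (Tf u t) (F.flatRun Su t)) hfu ht0S
      (by linarith) hr
  have hPS' : F.flatRun Su (g.t g.S) ∈ boxSet (boxOf (g.es e hn g.S) (g.P g.S)) := by rw [GridD.boxOf_es]; exact hPS
  have hmem := (g.step g.S).toRoughStepD.end_mem_onI (g.es e hn g.S) (hRDc g.S le_rfl) (hRD u hu g.S le_rfl) hc'.1
    hwfP hpsubS hPS' hτ' (Su := fun r => F.flatRun Su (g.t g.S + r)) (by simp) hrun ht hTI (i, F.widx hk)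
  simp only [GridD.es_val] at hmem
  rw [show g.t g.S + (F.τc - g.t g.S) = F.τc by ring] at hmem
  have hZc := IntervalD.mem_of_subset (hzlink _ (e (i, F.widx hk)).isLt) hmem
  -- the run of `u` at its flight time is that value
  have hτu : F.preclampTau u = F.τc := by simp only [preclampTau, h2, hclamp0, mul_zero, add_zero]
  have hval : F.runAt ε₀ α u i kk = F.flatRun Su F.τc (i, F.widx hk) := by
    simp only [runAt, slice_apply, flatRun, F.natCast_widx hk, hτu, hSudef]
  rw [hval]
  simp only [K3D.zlo, K3D.zhi, dif_pos hk, hek]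
  exact ⟨hZc.1, hZc.2⟩

end Glue

end OneShiftFrame

end DSSOneShift

end Summit.NavierStokesRegularity.NavierStokesRegularity.Theorems
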